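import Mathlib.RingTheory.Valuation.ValuationSubring
import Mathlib.Order.Zorn
import HarnessLib

/-!
# Minimal valuation subrings between a subalgebra and a valuation ring
# (crux `IndSmooth.ValuativeSmoothing`, line `birth`, stub `stub_existsMinimal`)

Stub `stub_existsMinimal` of the skeleton `Lines/birth.lean` (lead reshape r1) for crux
stmt-ResolutionOfSingularities-16087: for a field `K`, a valuation subring `O` of `K` and a
`k`-subalgebra `R ⊆ O`, there is a valuation subring `O'` with `R ⊆ O' ≤ O` which is MINIMAL with
this property. Proof: Zorn's lemma downwards on `{O' | R ⊆ O' ≤ O}` (applied in the order dual);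
the intersection of a non-empty chain of valuation subrings of `K` is again a valuation subring —
if `x` is not in the intersection, some member `O₁` of the chain omits `x`; members below `O₁` omit
`x` too and hence contain `x⁻¹`, members above `O₁` contain `x⁻¹ ∈ O₁`.

This is the first half of the reduction of the crux to ZERO-DIMENSIONAL valuation rings (a minimal
`O'` has residue field algebraic over `k`, by the companion stub `stub_refineOfNotZeroDim`).
-/

-- single-problem summit: the doubled namespace component is forced
set_option linter.dupNamespace false

namespace Summit.ResolutionOfSingularities.ResolutionOfSingularities.Theorems.ValuativeSmoothing

/-- **The intersection of a non-empty chain of valuation subrings is a valuation subring**, in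
the form: a non-empty chain `c` of valuation subrings of `K` has a lower bound which is a
valuation subring whose underlying subring is `⨅ O' ∈ c, O'`. [folklore] -/
theorem exists_valuationSubring_toSubring_eq_iInf {K : Type*} [Field K]
    (c : Set (ValuationSubring K)) (hc : IsChain (· ≤ ·) c) :
    ∃ L : ValuationSubring K, L.toSubring = ⨅ O' ∈ c, (O' : ValuationSubring K).toSubring := by
  classical
  refine ⟨{ toSubring := ⨅ O' ∈ c, (O' : ValuationSubring K).toSubring, mem_or_inv_mem' := ?_ },
    rfl⟩
  intro x
  change x ∈ (⨅ O' ∈ c, (O' : ValuationSubring K).toSubring) ∨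
    x⁻¹ ∈ (⨅ O' ∈ c, (O' : ValuationSubring K).toSubring)
  simp only [Subring.mem_iInf]
  by_cases hx : ∀ O' ∈ c, x ∈ (O' : ValuationSubring K).toSubring
  · exact Or.inl hx
  · push Not at hx
    obtain ⟨O₁, hO₁, hx₁⟩ := hx
    have hx₁' : x ∉ O₁ := hx₁
    refine Or.inr fun O' hO' => ?_
    rcases hc.total hO' hO₁ with h | h
    · -- `O' ≤ O₁`: `x ∉ O'`, so `x⁻¹ ∈ O'`
      have hx' : x ∉ O' := fun hxO' => hx₁' (h hxO')
      exact (O'.mem_or_inv_mem x).resolve_left hx'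
    · -- `O₁ ≤ O'`: `x⁻¹ ∈ O₁ ≤ O'`
      exact h ((O₁.mem_or_inv_mem x).resolve_left hx₁')

/-- **Stub `stub_existsMinimal` (line `birth`, crux `IndSmooth.ValuativeSmoothing`).** For a
valuation subring `O` of the field `K` and a `k`-subalgebra `R` of `K` with `R ⊆ O`, there is a
valuation subring `O'` with `R ⊆ O' ≤ O` and minimal with this property: every valuation subring
`O'' ≤ O'` containing `R` equals `O'`. Zorn's lemma downwards, chains being bounded below by their
intersection (`exists_valuationSubring_toSubring_eq_iInf`). [folklore] -/
theorem stub_existsMinimal (k K : Type) [Field k] [Field K] [Algebra k K]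
    (O : ValuationSubring K) (R : Subalgebra k K) (hRO : R.toSubring ≤ O.toSubring) :
    ∃ O' : ValuationSubring K, R.toSubring ≤ O'.toSubring ∧ O' ≤ O ∧
      ∀ O'' : ValuationSubring K, R.toSubring ≤ O''.toSubring → O'' ≤ O' → O'' = O' := by
  classical
  -- valuation subrings between `R` and `O`, in the ORDER DUAL (so that Zorn gives minimal ones)
  let S : Set (ValuationSubring K)ᵒᵈ :=
    {z | R.toSubring ≤ (OrderDual.ofDual z).toSubring ∧ OrderDual.ofDual z ≤ O}
  have hOS : OrderDual.toDual O ∈ S := ⟨hRO, le_rfl⟩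
  have ih : ∀ c ⊆ S, IsChain (· ≤ ·) c → ∀ y ∈ c, ∃ ub ∈ S, ∀ z ∈ c, z ≤ ub := by
    intro c hcS hc y hy
    -- the chain, read in `ValuationSubring K`
    let c' : Set (ValuationSubring K) := OrderDual.ofDual '' c
    have hc' : IsChain (· ≤ ·) c' := by
      rintro _ ⟨a, ha, rfl⟩ _ ⟨b, hb, rfl⟩ hne
      have hne' : a ≠ b := fun e => hne (by rw [e])
      rcases hc ha hb hne' with h | h
      · exact Or.inr h
      · exact Or.inl h
    obtain ⟨L, hL⟩ := exists_valuationSubring_toSubring_eq_iInf c' hc'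
    have hLle : ∀ z ∈ c, L ≤ OrderDual.ofDual z := by
      intro z hz x hx
      have hx' : x ∈ L.toSubring := hx
      rw [hL, Subring.mem_iInf] at hx'
      have := hx' (OrderDual.ofDual z)
      rw [Subring.mem_iInf] at this
      exact this ⟨z, hz, rfl⟩
    refine ⟨OrderDual.toDual L, ⟨?_, ?_⟩, fun z hz => hLle z hz⟩
    · -- `R ⊆ L`
      intro x hx
      change x ∈ L.toSubring
      rw [hL, Subring.mem_iInf]
      intro O'
      rw [Subring.mem_iInf]
      rintro ⟨z, hz, rfl⟩
      exact (hcS hz).1 hx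
    · -- `L ≤ O` through the member `y`
      exact (hLle y hy).trans (hcS hy).2
  obtain ⟨m, -, hm⟩ := zorn_le_nonempty₀ S ih (OrderDual.toDual O) hOS
  refine ⟨OrderDual.ofDual m, hm.1.1, hm.1.2, fun O'' hR'' hle => ?_⟩
  have hS'' : OrderDual.toDual O'' ∈ S := ⟨hR'', hle.trans hm.1.2⟩
  have h := hm.2 hS'' hle
  exact le_antisymm hle h

end Summit.ResolutionOfSingularities.ResolutionOfSingularities.Theorems.ValuativeSmoothing
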